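import Summits.QuantumFields.BalabanUV.Beta.GAN24.SrecWilsonSector
import Summits.QuantumFields.BalabanUV.Beta.GAN24.AffineUnroll
import Summits.QuantumFields.BalabanUV.Beta.GAN24.RespStepBm

/-!
# `BalabanUV.Beta.GAN24.SrecBornSector` — binder row G-an2-4 / (CONV-C), CT-ROUTE (row owner's `gen19/CT3-MECHANISM-v1.2.md` §D (D2); the owner's CALL
# [GAN24P1-G19-P1] «(E-α-V): the closed form of `bornSecAt (k+1)` in units»): THE VH∕Λ-BORN REMAINDER OF leaf-10's RECURSIVE FAMILY `SrecAt`, UNROLLED —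
# every level-`i` source is pushed ONCE through the co-dressed step `i` and then through the dressed three-leg chain of the levels `i+1, …, k−1`

NOT IN PRINT; OUR BOOKKEEPING (G-an2-4 formalisation swarm → CRUX TEAM (2), leaf seat `b2b-balaban-gan24-formalise-leaf-03`, gen 52; the owner's CALL (journal
`CLAIMS.log` l.32211), MINE l.32246).  [folklore] bookkeeping over tree theorems BY NAME: leaf-01's discrete Duhamel engine `AffineUnroll.eq_transport_add_sum`
(an affine recursion whose level maps are additive ON A CLASS), my `SrecWilsonSector.bornSecAt_succ` (the decoupled recursion) and `e3K_coDressKBmAt_KStepUnit_of_isFF`,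
the owner's g12 `SrecUnits.unitS_cubicPiece_eq` (units), asym1's `unitK_coDressKBmAt`, leaf-01's `SrecLinearPartEq.e3K_add` ∕ `Push3Nest.transport_push₃`,
an2's `locStencil_e3OfK`; TWO bookkeeping `def`s (`freshAt` — the sources; `stepMap` ∕ `unitStepMap` — the level maps, native and in units); 0 cited facts,
0 `def … : Prop`, 0 sorry.  HONEST FRAMING (cell contract, verbatim): «discharging `BetaPertH` makes Bałaban's UV stability UNCONDITIONAL — a real constructive-QFT
result; it is NOT the continuum limit and NOT the Clay problem.»  HONEST DEPENDENCY (verbatim): «continuum YM on T⁴ ⇐ BetaPertH ∧ nine spine estimates (0/9 proved);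
BetaPertH ⇐ (D1) ∧ (D4) ∧ CAP+tail; G-an2-4 gates asym, D1 and NE2/3/4.»

## What (generic `d`; in-block root `ρ = toSite rr` where stated)
* §1 `freshAt ρ cVH cΛ j` — the SOURCES: member 0's border + Λ sectors (`S0NAt` minus its Wilson summand), member `j+1`'s fresh `(cVH·wVH)•vhSAt + (cΛ·wΛ)•SLam…`;
  `stepMap ρ cE j S := (cE·wE (j+1)) • e3OfK Lc (coDressKBmAt ρ Lc (KInvStep Lc j)) S` (the level map of the recursion); `bornSecAt_zero_eq_freshAt`, `bornSecAt_succ_eq`.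
* §2 THE CLASS `∃ Cs δ, 0 < δ ∧ LocStencil S Cs δ` (no `def`): contains `0`, closed under `+` and scalars, preserved by `stepMap` (`locStencil_e3OfK`), and `stepMap`
  is ADDITIVE on it (`e3K_add`); the remainder, the Wilson lineage and hence every source are in the class.
* §3 **`bornSecAt_eq_sum_transport`** — `bornSecAt k = transport stepMap 0 k (freshAt 0) + Σ_{m<k} transport stepMap (m+1) (k−1−m) (freshAt (m+1))`.
* §4 UNITS: `unitStepMap ρ cE j S := (cE·Lc^{2(d+1)}) • e3K (coDressKBmAt ρ Lc (KStepUnit Lc j)) Lc S`; **`unitS_stepMap`** (generic table, no hypothesis) and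
  **`unitS_transport_stepMap`** (`unitS_{m+n} ∘ transport stepMap m n = transport unitStepMap m n ∘ unitS_m`).
* §5 **`transport_unitStepMap_succ_eq_push₃`** — for an ff-valued LOCAL table `X`: `transport unitStepMap m (n+1) X = (cE·Lc^{2(d+1)})^{n+1} • push₃ T T T X`,
  `T = legChain (respStepBmSeq ρ Lc) m n` (every base `m`); the first push of a NON-ff source is leaf-01 g43's four-channel `RespStepBm.e3K_coDressKBmAt_KStepUnit`
  (multiplier legs UNDRESSED), its image ff-valued and local — so §5 applies from the next level on.
* §6 THE CLOSED FORM **`unitS_bornSecAt_eq_sum`**: `unitS_k (bornSecAt k) = transport unitStepMap 0 k (unitS_0 (freshAt 0)) + Σ_{m<k} transport unitStepMap (m+1) (k−1−m)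
  (unitS_{m+1} (freshAt (m+1)))`.
Discharges NO slot letter; asserts NO shape of Bałaban's stencils; 0 wall binders; NEVER «G-an2-4 closed»; NOT D1, NOT BetaPertH, NOT continuum, NOT Clay.
-/

noncomputable section

open Finset
open scoped BigOperators
open Literature.MathematicalPhysics.QuantumFieldTheory
open Literature.MathematicalPhysics.QuantumFieldTheory.Balaban1983to89
open Literature.MathematicalPhysics.QuantumFieldTheory.Balaban1983to89.Beta
open ExpKernelCalculus (MKer Decays)
open AffineAveraging (box toSite)
open OneStepResolventKernel (Fib LocStencil KInv)
open OneStepKernelFamily (KInvStep decays_KInvStep)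
open BalabanStepJetsSucc (wE wVH wΛ E2 lamCoeffK)
open StepJetData (wilsonA locStencil_add locStencil_smul)
open BalabanStepJets (lamCoeffOf locStencil_mono)
open AveragingHessianKernelsRooted (vhSAt hessFFAt)
open InterLevelTransport (SLam)
open Summit.QuantumFields.BalabanUV.Beta.HessKerDressedUnits (unitK unitS unitS_apply decays_unitK locStencil_unitS)
open Summit.QuantumFields.BalabanUV.Beta.GAN24.CombesThomas (sfStep smStep sfStep_ne_zero smStep_ne_zero KStepUnit)
open Summit.QuantumFields.BalabanUV.Beta.GAN24.ThirdJetKernel (e3K)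
open Summit.QuantumFields.BalabanUV.Beta.AxialDressingRooted (coDressKBmAt one_le_of_neZero decays_coDressKBmAt_KInvStep)
open Summit.QuantumFields.BalabanUV.Beta.HessKerCoDressedBmWall (unitK_coDressKBmAt)
open Summit.QuantumFields.BalabanUV.Beta.SpineRooted (e3OfK locStencil_e3OfK S0NAt)
open Summit.QuantumFields.BalabanUV.Beta.WardLocusRecursive (SrecAt locStencil_SrecAt)
open Summit.QuantumFields.BalabanUV.Beta.GAN24.CubicReadoutDecLift (e3OfK_eq_e3K)
open Summit.QuantumFields.BalabanUV.Beta.GAN24.SrecUnits (unitS_cubicPiece_eq KStepUnit_eq)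
open Summit.QuantumFields.BalabanUV.Beta.GAN24.StencilSlotOfShapes (unitS_add)
open Summit.QuantumFields.BalabanUV.Beta.GAN24.Push4 (IsFF)
open Summit.QuantumFields.BalabanUV.Beta.GAN24.Push4Iter (LegFam legChain)
open Summit.QuantumFields.BalabanUV.Beta.GAN24.Push3 (push₃ push₃_smul isFF_push₃)
open Summit.QuantumFields.BalabanUV.Beta.GAN24.AffineUnroll (transport transport_zero transport_succ eq_transport_add_sum transport_mem)
open Summit.QuantumFields.BalabanUV.Beta.GAN24.Push3Nest (transport_push₃)
open Summit.QuantumFields.BalabanUV.Beta.GAN24.SrecLinearPartEq (e3K_add)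
open Summit.QuantumFields.BalabanUV.Beta.GAN24.RespStepBmDecompExact (respStepBmSeq)
open Summit.QuantumFields.BalabanUV.Beta.GAN24.SrecWilsonSector (wilsonSecAt bornSecAt bornSecAt_zero bornSecAt_succ isFF_smul
  e3K_coDressKBmAt_KStepUnit_of_isFF legDecay_respStepBmSeq locStencil_wilsonSecAt locStencil_bornSecAt)

namespace Summit.QuantumFields.BalabanUV.Beta.GAN24.SrecBornSector

variable {d : ℕ} {Lc : ℕ} [NeZero Lc]

/-! ## §1 Sources and level maps -/

section Defs

variable (Lc)

/-- [our object — bookkeeping, asserting nothing] **THE SOURCES OF THE REMAINDER**: member `0` = the border and Λ sectors of the native spine `S0NAt` (its Wilson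
summand removed); member `j+1` = the FRESH border and Λ sectors that `WardLocusRecursive.SrecAt_succ` adds at level `j+1`. -/
def freshAt (ρ : Fin (d + 1) → ℤ) (cVH cΛ : ℝ) : ℕ → Fin (d + 1) → (Fin (d + 1) → ℤ) → MKer (d + 1) (Fib d)
  | 0 => fun κ' u' => cVH • vhSAt ρ d Lc rfl κ' u' + cΛ • SLam Lc (lamCoeffOf (KInv (N := Lc) (d := d)) Lc) (fun μ y => hessFFAt ρ Lc μ y) κ' u'
  | j + 1 => fun κ' u' => (cVH * wVH d Lc (j + 1)) • vhSAt ρ d Lc rfl κ' u' +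
      (cΛ * wΛ d Lc (j + 1)) • SLam Lc (lamCoeffK (KInvStep (d := d) Lc (j + 1)) (E2 d Lc (j + 1)) Lc) (fun μ y => hessFFAt ρ Lc μ y) κ' u'

/-- [our object — bookkeeping, asserting nothing] **THE LEVEL MAP OF THE RECURSION** (native units): `stepMap ρ cE j S = (cE·wE (j+1)) • e3OfK Lc Ĝ_j S`,
`Ĝ_j = coDressKBmAt ρ Lc (KInvStep Lc j)`. -/
def stepMap (ρ : Fin (d + 1) → ℤ) (cE : ℝ) (j : ℕ) (S : Fin (d + 1) → (Fin (d + 1) → ℤ) → MKer (d + 1) (Fib d)) :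
    Fin (d + 1) → (Fin (d + 1) → ℤ) → MKer (d + 1) (Fib d) :=
  fun κ' u' => (cE * wE d Lc (j + 1)) • e3OfK Lc (coDressKBmAt ρ Lc (KInvStep (d := d) Lc j)) S κ' u'

/-- [our object — bookkeeping, asserting nothing] **THE LEVEL MAP IN THE ADOPTED UNITS**: `unitStepMap ρ cE j S = (cE·Lc^{2(d+1)}) • e3K (coDressKBmAt ρ Lc K̃_j) Lc S`,
`K̃_j = KStepUnit Lc j` — the j-FREE weight of `SrecUnits.cubic_unit_factor`. -/
def unitStepMap (ρ : Fin (d + 1) → ℤ) (cE : ℝ) (j : ℕ) (S : Fin (d + 1) → (Fin (d + 1) → ℤ) → MKer (d + 1) (Fib d)) :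
    Fin (d + 1) → (Fin (d + 1) → ℤ) → MKer (d + 1) (Fib d) :=
  fun κ' u' => (cE * (Lc : ℝ) ^ (2 * (d + 1))) • e3K (coDressKBmAt ρ Lc (KStepUnit (d := d) Lc j)) Lc S κ' u'

variable {Lc}

/-- [folklore] Member `0` of the remainder is the source `freshAt 0` (`S0NAt = cE•wilsonA + cVH•vhSAt + cΛ•SLam…`). -/
theorem bornSecAt_zero_eq_freshAt (ρ : Fin (d + 1) → ℤ) (cE cVH cΛ : ℝ) : bornSecAt Lc ρ cE cVH cΛ 0 = freshAt Lc ρ cVH cΛ 0 := by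
  rw [bornSecAt_zero]
  funext κ' u'
  show S0NAt d Lc ρ cE cVH cΛ κ' u' - cE • wilsonA d κ' u' = _
  simp only [S0NAt, freshAt]
  abel

/-- [folklore] The decoupled recursion in `stepMap` ∕ `freshAt` form (my `bornSecAt_succ`; in-block root). -/
theorem bornSecAt_succ_eq {rr : Fin (d + 1) → ℕ} (hrr : rr ∈ box (d + 1) Lc) (cE cVH cΛ : ℝ) (j : ℕ) :
    bornSecAt Lc (toSite rr) cE cVH cΛ (j + 1) = stepMap Lc (toSite rr) cE j (bornSecAt Lc (toSite rr) cE cVH cΛ j) + freshAt Lc (toSite rr) cVH cΛ (j + 1) := by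
  rw [bornSecAt_succ hrr]
  funext κ' u'
  simp only [stepMap, freshAt, Pi.add_apply]
  abel

end Defs

/-! ## §2 The class of local stencil families -/

/- The CLASS on which the level maps are additive (no `def`): `∃ Cs δ, 0 < δ ∧ LocStencil S Cs δ` — local stencil families at SOME positive rate. -/

omit [NeZero Lc] in
/-- [folklore] `0` is in the class. -/
theorem isLoc_zero : ∃ Cs δ : ℝ, 0 < δ ∧ LocStencil (0 : Fin (d + 1) → (Fin (d + 1) → ℤ) → MKer (d + 1) (Fib d)) Cs δ :=
  ⟨0, 1, one_pos, fun κ' u' x z a b => by simp⟩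

omit [NeZero Lc] in
/-- [folklore] The class is closed under addition (common rate `min δ δ′`). -/
theorem isLoc_add {S S' : Fin (d + 1) → (Fin (d + 1) → ℤ) → MKer (d + 1) (Fib d)} (hS : ∃ Cs δ : ℝ, 0 < δ ∧ LocStencil S Cs δ) (hS' : ∃ Cs δ : ℝ, 0 < δ ∧ LocStencil S' Cs δ) :
    ∃ Cs δ : ℝ, 0 < δ ∧ LocStencil (S + S') Cs δ := by
  obtain ⟨C, δ, hδ, h⟩ := hS
  obtain ⟨C', δ', hδ', h'⟩ := hS'
  have hC : 0 ≤ C := (h 0 0).nonneg (Sum.inl 0)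
  have hC' : 0 ≤ C' := (h' 0 0).nonneg (Sum.inl 0)
  exact ⟨C + C', min δ δ', lt_min hδ hδ',
    locStencil_add (locStencil_mono h hC (min_le_left _ _)) (locStencil_mono h' hC' (min_le_right _ _))⟩

omit [NeZero Lc] in
/-- [folklore] The class is closed under scalars. -/
theorem isLoc_smul {S : Fin (d + 1) → (Fin (d + 1) → ℤ) → MKer (d + 1) (Fib d)} (hS : ∃ Cs δ : ℝ, 0 < δ ∧ LocStencil S Cs δ) (c : ℝ) :
    ∃ Cs δ : ℝ, 0 < δ ∧ LocStencil (fun κ u => c • S κ u) Cs δ := by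
  obtain ⟨C, δ, hδ, h⟩ := hS
  exact ⟨_, δ, hδ, locStencil_smul c h⟩

/-- [folklore] **THE LEVEL MAP PRESERVES THE CLASS** (in-block root; an2's `locStencil_e3OfK` with `decays_coDressKBmAt_KInvStep`). -/
theorem isLoc_stepMap {rr : Fin (d + 1) → ℕ} (hrr : rr ∈ box (d + 1) Lc) (cE : ℝ) (j : ℕ)
    {S : Fin (d + 1) → (Fin (d + 1) → ℤ) → MKer (d + 1) (Fib d)} (hS : ∃ Cs δ : ℝ, 0 < δ ∧ LocStencil S Cs δ) :
    ∃ Cs δ : ℝ, 0 < δ ∧ LocStencil (stepMap Lc (toSite rr) cE j S) Cs δ := by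
  obtain ⟨C, δ, hδ, h⟩ := hS
  obtain ⟨C₁, δ₁, hδ₁, h1⟩ := locStencil_e3OfK (N := Lc) (one_le_of_neZero Lc) (decays_coDressKBmAt_KInvStep (d := d) hrr j) h hδ
  exact ⟨_, δ₁, hδ₁, locStencil_smul _ h1⟩

/-- [folklore] **THE LEVEL MAP IS ADDITIVE ON THE CLASS** (leaf-01's `SrecLinearPartEq.e3K_add`: the cubic functional of a decaying kernel is additive on local families). -/
theorem stepMap_add {rr : Fin (d + 1) → ℕ} (hrr : rr ∈ box (d + 1) Lc) (cE : ℝ) (j : ℕ)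
    {S S' : Fin (d + 1) → (Fin (d + 1) → ℤ) → MKer (d + 1) (Fib d)} (hS : ∃ Cs δ : ℝ, 0 < δ ∧ LocStencil S Cs δ)
    (hS' : ∃ Cs δ : ℝ, 0 < δ ∧ LocStencil S' Cs δ) :
    stepMap Lc (toSite rr) cE j (S + S') = stepMap Lc (toSite rr) cE j S + stepMap Lc (toSite rr) cE j S' := by
  obtain ⟨C, δ, hδ, h⟩ := hS
  obtain ⟨C', δ', hδ', h'⟩ := hS'
  obtain ⟨δG, CG, hδG, -, hG⟩ := decays_coDressKBmAt_KInvStep (d := d) hrr j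
  funext κ' u'
  simp only [stepMap, Pi.add_apply]
  rw [e3OfK_eq_e3K, e3OfK_eq_e3K, e3OfK_eq_e3K, ← smul_add,
    ← e3K_add hG hδG Lc h h' hδ hδ' κ' u']
  rfl

/-- [folklore] The remainder, hence every source, is in the class (my `locStencil_bornSecAt`; `freshAt (j+1) = bornSecAt (j+1) − stepMap j (bornSecAt j)`). -/
theorem isLoc_freshAt {rr : Fin (d + 1) → ℕ} (hrr : rr ∈ box (d + 1) Lc) (cE cVH cΛ : ℝ) :
    ∀ j, ∃ Cs δ : ℝ, 0 < δ ∧ LocStencil (freshAt Lc (toSite rr) cVH cΛ j) Cs δ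
  | 0 => by rw [← bornSecAt_zero_eq_freshAt (toSite rr) cE]; exact locStencil_bornSecAt hrr cE cVH cΛ 0
  | j + 1 => by
    have e : freshAt Lc (toSite rr) cVH cΛ (j + 1)
        = bornSecAt Lc (toSite rr) cE cVH cΛ (j + 1) + fun κ u => (-1 : ℝ) • stepMap Lc (toSite rr) cE j (bornSecAt Lc (toSite rr) cE cVH cΛ j) κ u := by
      rw [bornSecAt_succ_eq hrr]; funext κ u; simp only [Pi.add_apply, neg_one_smul]; abel
    rw [e]
    exact isLoc_add (locStencil_bornSecAt hrr cE cVH cΛ (j + 1)) (isLoc_smul (isLoc_stepMap hrr cE j (locStencil_bornSecAt hrr cE cVH cΛ j)) _)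

/-! ## §3 The unrolled remainder (leaf-01's discrete Duhamel engine) -/

/-- NOT IN PRINT; OUR BOOKKEEPING.  **THE REMAINDER UNROLLED** (in-block root): `bornSecAt k = transport stepMap 0 k (freshAt 0) + Σ_{m<k} transport stepMap (m+1) (k−1−m)
(freshAt (m+1))` — every level-`i` source transported through the level maps `i, …, k−1` (`AffineUnroll.eq_transport_add_sum` on the class of local families). -/
theorem bornSecAt_eq_sum_transport {rr : Fin (d + 1) → ℕ} (hrr : rr ∈ box (d + 1) Lc) (cE cVH cΛ : ℝ) (k : ℕ) :
    bornSecAt Lc (toSite rr) cE cVH cΛ k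
      = transport (stepMap Lc (toSite rr) cE) 0 k (freshAt Lc (toSite rr) cVH cΛ 0)
        + ∑ m ∈ Finset.range k, transport (stepMap Lc (toSite rr) cE) (m + 1) (k - 1 - m) (freshAt Lc (toSite rr) cVH cΛ (m + 1)) := by
  have h := eq_transport_add_sum (A := stepMap Lc (toSite rr) cE)
    (P := fun S => ∃ Cs δ : ℝ, 0 < δ ∧ LocStencil S Cs δ) isLoc_zero (fun x y hx hy => isLoc_add hx hy)
    (fun j x hx => isLoc_stepMap hrr cE j hx) (fun j x y hx hy => stepMap_add hrr cE j hx hy)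
    (x := bornSecAt Lc (toSite rr) cE cVH cΛ) (b := fun j => freshAt Lc (toSite rr) cVH cΛ (j + 1))
    (by rw [bornSecAt_zero_eq_freshAt]; exact isLoc_freshAt hrr cE cVH cΛ 0) (fun j => isLoc_freshAt hrr cE cVH cΛ (j + 1))
    (fun j => bornSecAt_succ_eq hrr cE cVH cΛ j) k
  rw [bornSecAt_zero_eq_freshAt] at h
  exact h

/-! ## §4 Units -/

/-- [folklore] **THE LEVEL MAP IN UNITS** (generic table, NO hypothesis; the owner's `SrecUnits.unitS_cubicPiece_eq` + asym1's `unitK_coDressKBmAt`):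
`unitS_{j+1} (stepMap j S) = unitStepMap j (unitS_j S)`. -/
theorem unitS_stepMap (ρ : Fin (d + 1) → ℤ) (cE : ℝ) (j : ℕ) (S : Fin (d + 1) → (Fin (d + 1) → ℤ) → MKer (d + 1) (Fib d)) :
    unitS (sfStep Lc (j + 1)) (smStep d Lc (j + 1)) (stepMap Lc ρ cE j S)
      = unitStepMap Lc ρ cE j (unitS (sfStep Lc j) (smStep d Lc j) S) := by
  have hsfj : sfStep Lc j ≠ 0 := sfStep_ne_zero j
  have hsmj : smStep d Lc j ≠ 0 := smStep_ne_zero (d := d) j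
  have e : stepMap Lc ρ cE j S = fun κ' u' => (cE * wE d Lc (j + 1)) • e3K (coDressKBmAt ρ Lc (KInvStep (d := d) Lc j)) Lc S κ' u' := by
    funext κ' u'
    show (cE * wE d Lc (j + 1)) • e3OfK Lc (coDressKBmAt ρ Lc (KInvStep (d := d) Lc j)) S κ' u' = _
    rw [e3OfK_eq_e3K]
  rw [e, unitS_cubicPiece_eq cE j, unitK_coDressKBmAt ρ Lc hsfj hsmj (KInvStep (d := d) Lc j), ← KStepUnit_eq]
  rfl

/-- [folklore] **UNITS COMMUTE WITH THE TRANSPORT**: `unitS_{m+n} (transport stepMap m n S) = transport unitStepMap m n (unitS_m S)` (induction on `n`; generic table). -/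
theorem unitS_transport_stepMap (ρ : Fin (d + 1) → ℤ) (cE : ℝ) (m : ℕ) (S : Fin (d + 1) → (Fin (d + 1) → ℤ) → MKer (d + 1) (Fib d)) :
    ∀ n, unitS (sfStep Lc (m + n)) (smStep d Lc (m + n)) (transport (stepMap Lc ρ cE) m n S)
      = transport (unitStepMap Lc ρ cE) m n (unitS (sfStep Lc m) (smStep d Lc m) S)
  | 0 => by simp only [Nat.add_zero, transport_zero]
  | n + 1 => by
    rw [transport_succ, transport_succ, ← unitS_transport_stepMap ρ cE m S n, show m + (n + 1) = m + n + 1 from rfl, unitS_stepMap]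

/-- [folklore] The same with the total level named (`m + n = t`). -/
theorem unitS_transport_stepMap' (ρ : Fin (d + 1) → ℤ) (cE : ℝ) {m n t : ℕ} (ht : m + n = t)
    (S : Fin (d + 1) → (Fin (d + 1) → ℤ) → MKer (d + 1) (Fib d)) :
    unitS (sfStep Lc t) (smStep d Lc t) (transport (stepMap Lc ρ cE) m n S)
      = transport (unitStepMap Lc ρ cE) m n (unitS (sfStep Lc m) (smStep d Lc m) S) := by
  subst ht; exact unitS_transport_stepMap ρ cE m S n

/-! ## §5 The transport in units of an ff-valued local table is ONE three-leg push through the dressed leg chain -/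

/-- [folklore] On an ff-valued table the unit level map is one push (my `e3K_coDressKBmAt_KStepUnit_of_isFF`). -/
theorem unitStepMap_of_isFF (ρ : Fin (d + 1) → ℤ) (cE : ℝ) (j : ℕ) {S : Fin (d + 1) → (Fin (d + 1) → ℤ) → MKer (d + 1) (Fib d)}
    (hS : ∀ κ u, IsFF (S κ u)) :
    unitStepMap Lc ρ cE j S = fun κ' u' => (cE * (Lc : ℝ) ^ (2 * (d + 1))) •
      push₃ (respStepBmSeq ρ Lc j) (respStepBmSeq ρ Lc j) (respStepBmSeq ρ Lc j) S κ' u' := by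
  funext κ' u'
  show (cE * (Lc : ℝ) ^ (2 * (d + 1))) • e3K (coDressKBmAt ρ Lc (KStepUnit (d := d) Lc j)) Lc S κ' u' = _
  rw [e3K_coDressKBmAt_KStepUnit_of_isFF ρ j hS κ' u']

/-- [folklore] The transport of pushes keeps ff-valuedness. -/
theorem isFF_transport_push (R : ℕ → LegFam d) (m : ℕ) {S : Fin (d + 1) → (Fin (d + 1) → ℤ) → MKer (d + 1) (Fib d)} (hS : ∀ κ u, IsFF (S κ u)) :
    ∀ (n : ℕ) (κ : Fin (d + 1)) (u : Fin (d + 1) → ℤ), IsFF (transport (fun j T => push₃ (R j) (R j) (R j) T) m n S κ u)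
  | 0, κ, u => by rw [transport_zero]; exact hS κ u
  | n + 1, κ, u => by rw [transport_succ]; exact isFF_push₃ _ _ _ _ κ u

/-- [folklore] **THE UNIT TRANSPORT OF AN ff-VALUED TABLE IS THE SCALED TRANSPORT OF PUSHES** (hypothesis-free induction; `push₃_smul`). -/
theorem transport_unitStepMap_succ_eq_transport (ρ : Fin (d + 1) → ℤ) (cE : ℝ) (m : ℕ)
    {S : Fin (d + 1) → (Fin (d + 1) → ℤ) → MKer (d + 1) (Fib d)} (hS : ∀ κ u, IsFF (S κ u)) :
    ∀ n, transport (unitStepMap Lc ρ cE) m (n + 1) S = fun κ' u' => (cE * (Lc : ℝ) ^ (2 * (d + 1))) ^ (n + 1) •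
      transport (fun j T => push₃ (respStepBmSeq ρ Lc j) (respStepBmSeq ρ Lc j) (respStepBmSeq ρ Lc j) T) m (n + 1) S κ' u'
  | 0 => by
    rw [transport_succ, transport_zero, unitStepMap_of_isFF ρ cE (m + 0) hS]
    funext κ' u'
    simp only [transport_succ, transport_zero, zero_add, pow_one]
  | n + 1 => by
    rw [transport_succ, transport_unitStepMap_succ_eq_transport ρ cE m hS n,
      unitStepMap_of_isFF ρ cE (m + (n + 1)) (fun κ u => isFF_smul (isFF_transport_push _ m hS (n + 1) κ u) _)]
    funext κ' u'
    show (cE * (Lc : ℝ) ^ (2 * (d + 1))) •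
        push₃ (respStepBmSeq ρ Lc (m + (n + 1))) (respStepBmSeq ρ Lc (m + (n + 1))) (respStepBmSeq ρ Lc (m + (n + 1)))
          (fun κ u => (cE * (Lc : ℝ) ^ (2 * (d + 1))) ^ (n + 1) •
            transport (fun j T => push₃ (respStepBmSeq ρ Lc j) (respStepBmSeq ρ Lc j) (respStepBmSeq ρ Lc j) T) m (n + 1) S κ u) κ' u' = _
    rw [push₃_smul, smul_smul]
    simp only [transport_succ]
    congr 1
    ring

/-- NOT IN PRINT; OUR BOOKKEEPING.  **THE UNIT TRANSPORT OF AN ff-VALUED LOCAL TABLE THROUGH `n+1` LEVELS FROM BASE `m` IS ONE THREE-LEG PUSH THROUGH THE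
DRESSED LEG CHAIN** (in-block root): `transport unitStepMap m (n+1) X = fun κ′ u′ ↦ (cE·Lc^{2(d+1)})^{n+1} • push₃ T T T X κ′ u′`, `T = legChain (respStepBmSeq ρ Lc) m n`
(leaf-01's `transport_push₃`; my `legDecay_respStepBmSeq`).  With `m = 0`, `X = cE • wilsonA` this is (E-α-W). -/
theorem transport_unitStepMap_succ_eq_push₃ {rr : Fin (d + 1) → ℕ} (hrr : rr ∈ box (d + 1) Lc) (cE : ℝ) (m : ℕ)
    {S : Fin (d + 1) → (Fin (d + 1) → ℤ) → MKer (d + 1) (Fib d)} (hS : ∀ κ u, IsFF (S κ u)) (hSl : ∃ Cs δ : ℝ, 0 < δ ∧ LocStencil S Cs δ) (n : ℕ) :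
    transport (unitStepMap Lc (toSite rr) cE) m (n + 1) S = fun κ' u' => (cE * (Lc : ℝ) ^ (2 * (d + 1))) ^ (n + 1) •
      push₃ (legChain (respStepBmSeq (toSite rr) Lc) m n) (legChain (respStepBmSeq (toSite rr) Lc) m n)
        (legChain (respStepBmSeq (toSite rr) Lc) m n) S κ' u' := by
  rw [transport_unitStepMap_succ_eq_transport (toSite rr) cE m hS n,
    transport_push₃ (one_le_of_neZero Lc) (legDecay_respStepBmSeq hrr) (legDecay_respStepBmSeq hrr) (legDecay_respStepBmSeq hrr) hSl m n]

/-! ## §6 The closed form in units -/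

omit [NeZero Lc] in
/-- [folklore] `unitS` over a finite sum of families. -/
theorem unitS_finset_sum (sf sm : ℝ) (s : Finset ℕ) (F : ℕ → Fin (d + 1) → (Fin (d + 1) → ℤ) → MKer (d + 1) (Fib d)) :
    unitS sf sm (∑ m ∈ s, F m) = ∑ m ∈ s, unitS sf sm (F m) := by
  classical
  induction s using Finset.induction_on with
  | empty =>
    funext κ u x y a b
    simp [unitS_apply]
  | insert a s ha ih =>
    rw [Finset.sum_insert ha, Finset.sum_insert ha, ← ih]
    funext κ u x y f g
    simp only [unitS_apply, Pi.add_apply]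
    ring

/-- NOT IN PRINT; OUR BOOKKEEPING ((E-α-V) of the row owner's CALL [GAN24P1-G19-P1]; [folklore]).
**THE VH∕Λ-BORN REMAINDER OF THE RECURSIVE FAMILY, MEMBER `k`, IN THE ADOPTED UNITS — CLOSED FORM**: for an in-block root and every `k`,
`unitS_k (bornSecAt k) = transport unitStepMap 0 k (unitS_0 (freshAt 0)) + Σ_{m<k} transport unitStepMap (m+1) (k−1−m) (unitS_{m+1} (freshAt (m+1)))`
— every level-`i` source, rescaled AT ITS OWN LEVEL, transported by the UNIT level maps `S ↦ (cE·Lc^{2(d+1)}) • e3K (coDressKBmAt ρ Lc K̃_j) Lc S`, `j = i … k−1`.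
By §5 each transport with `≥ 1` step is `(cE·Lc^{2(d+1)})^{·} •` ONE three-leg push of the (ff-valued, local) first-step image `unitStepMap i (unitS_i (freshAt i))`
through `legChain (respStepBmSeq ρ Lc) (i+1) ·`; the first step on the (non-ff) source is leaf-01 g43's four-channel `RespStepBm.e3K_coDressKBmAt_KStepUnit`
(multiplier legs undressed). -/
theorem unitS_bornSecAt_eq_sum {rr : Fin (d + 1) → ℕ} (hrr : rr ∈ box (d + 1) Lc) (cE cVH cΛ : ℝ) (k : ℕ) :
    unitS (sfStep Lc k) (smStep d Lc k) (bornSecAt Lc (toSite rr) cE cVH cΛ k)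
      = transport (unitStepMap Lc (toSite rr) cE) 0 k (unitS (sfStep Lc 0) (smStep d Lc 0) (freshAt Lc (toSite rr) cVH cΛ 0))
        + ∑ m ∈ Finset.range k, transport (unitStepMap Lc (toSite rr) cE) (m + 1) (k - 1 - m)
            (unitS (sfStep Lc (m + 1)) (smStep d Lc (m + 1)) (freshAt Lc (toSite rr) cVH cΛ (m + 1))) := by
  rw [bornSecAt_eq_sum_transport hrr cE cVH cΛ k]
  have e : (transport (stepMap Lc (toSite rr) cE) 0 k (freshAt Lc (toSite rr) cVH cΛ 0)
        + ∑ m ∈ Finset.range k, transport (stepMap Lc (toSite rr) cE) (m + 1) (k - 1 - m) (freshAt Lc (toSite rr) cVH cΛ (m + 1)))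
      = fun κ u => transport (stepMap Lc (toSite rr) cE) 0 k (freshAt Lc (toSite rr) cVH cΛ 0) κ u
        + (∑ m ∈ Finset.range k, transport (stepMap Lc (toSite rr) cE) (m + 1) (k - 1 - m) (freshAt Lc (toSite rr) cVH cΛ (m + 1))) κ u := by
    funext κ u; rfl
  rw [e, unitS_add, unitS_finset_sum, unitS_transport_stepMap' (toSite rr) cE (Nat.zero_add k)]
  funext κ u
  simp only [Pi.add_apply, Finset.sum_apply]
  congr 1
  refine Finset.sum_congr rfl fun m hm => ?_
  have hmk : m + 1 + (k - 1 - m) = k := by have := Finset.mem_range.1 hm; omega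
  rw [unitS_transport_stepMap' (toSite rr) cE hmk]

end Summit.QuantumFields.BalabanUV.Beta.GAN24.SrecBornSector

end
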